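import Literature.Barriers.FinalStateConjecture.ExtremalHorizonInstabilityAssembly
import Literature.Barriers.FinalStateConjecture.ExtremalHorizonInstabilityCauchyProofs
import HarnessLib

/-!
# Barrier catalogue `FinalStateConjecture`: the Aretakis instability from its analytic leaves
# (`Literature/Barriers/FinalStateConjecture/`, D-0021, D-0014; family `gr`)

The barrier `AretakisInstability` (`ExtremalHorizonInstability.lean`: Aretakis, ATMP 19 (2015),
Thm. 3, in existence form) is a named fact. This file **proves** its reduction to named facts that
are single published results:

* `AretakisInstability.of_kerrSchild` (this file):
  `KerrSchild.waveCauchyProblem → (Thm. 3, clauses k = 1, 2, universal asymptotic form) →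
  AretakisInstability` — the second hypothesis `hA` spelled out verbatim: it is the conclusion of
  the proved conditional theorems `Aretakis2015.scalarInstability_of_facts`
  (`ExtremalHorizonInstabilityAssembly.lean`) and `Aretakis2015.scalarInstability_of_decay`
  (`ExtremalHorizonBlowupProofs.lean`); until the review of 2026-08-15 it was the named fact
  `Aretakis2015_scalarInstability`, a pass-through node of the debt census merged back into the
  obligation of `AretakisInstability` under D-0026/D-0027. It is the composite
  of `Kerr.extremal_waveCauchy_of_kerrSchild` (`ExtremalHorizonInstabilityCauchyProofs.lean`:
  the chart-level Cauchy problem on the WHOLE extremal chart `Kerr.region M r₀`, `0 < r₀ < M`, from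
  the leaf fact — the chart metric is extended inside `{r ≤ r₀}` to a smooth generalised
  Kerr–Schild background `η + φ ℓ ⊗ ℓ` on `ℝ⁴`, the background equation is solved globally and the
  solution is restricted to the chart, `Kerr.exists_wave_of_data`) with
  `AretakisInstability.of_facts` (`ExtremalHorizonInstabilityProofs.lean`: solve with the localised
  data `(ψ₀, ψ₁) = (horizonBumpData, 0)`, compute the Aretakis charge `H₀ = 16πM² ≠ 0`
  (`aretakisCharge_eq_of_data`), obtain from Thm. 3 (`hA`) the lower
  bounds from some time `τ₁` on, and translate the solution by `s = max τ₁ 0` along the stationary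
  Killing flow `φ_s`, `Kerr.timeTranslate` — the wave operator, the transversal field `Y = ℓ♯` and
  the horizon are `φ_s`-invariant — which upgrades the printed *asymptotic* non-decay to the
  "every `τ ≥ 0`" clause of the existence form while the localisation of the data is preserved by
  the cone-hull clause);
* `Aretakis2015.scalarInstability_of_facts` (`ExtremalHorizonInstabilityAssembly.lean`):
  `Aretakis2012_pointwiseDecay → (k = 2 blow-up for axisymmetric solutions) → (Thm. 3)`
  (conservation of `H₀^{Kerr}` along `𝓗⁺` — proved, `Aretakis2015_chargeConservation_holds` — and
  the projection to the zeroth azimuthal frequency — proved, `ExtremalHorizonAxisymmetricProjection.lean`),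

and records the composite

`AretakisInstability.of_leafFacts :
    KerrSchild.waveCauchyProblem → Aretakis2012_pointwiseDecay →
      (k = 2 blow-up for axisymmetric solutions) → AretakisInstability`,

so that the trust base of the barrier is exactly the two leaves 1.–2. below together with the
`k = 2` clause 3., which is itself PROVED from leaf 2 (`Aretakis2015.axisymmetricBlowup_of_decay`,
`ExtremalHorizonBlowupProofs.lean`; the two-leaf composite is `AretakisInstability.of_twoLeaves`,
`ExtremalHorizonInstabilityNarrowLeaves.lean`):

1. `Literature.Geometry.Lorentzian.KerrSchild.waveCauchyProblem` — the global Cauchy problem with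
   domain of dependence for divergence-form wave operators of generalised Kerr–Schild metrics
   `η + φ ℓ ⊗ ℓ` on `ℝ⁴` (Hörmander 1997, §6.3; Bär–Ginoux–Pfäffle 2007, Thm. 3.2.11), already
   reduced to backgrounds flat outside spatially compact cylinders
   (`KerrSchild.waveCauchyProblem_of_tame`, `KerrSchildWaveCauchyReduction.lean`);
2. `Literature.Barriers.FinalStateConjecture.Aretakis2012_pointwiseDecay` — Aretakis, JFA 263
   (2012), Thm. 5: pointwise decay of axisymmetric solutions on extremal Kerr up to and including
   `𝓗⁺` (`ExtremalHorizonAxisymmetricDecay.lean`);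
3. the `k = 2` blow-up clause of Thm. 3 of the 2015 paper for axisymmetric solutions with
   `H₀[ψ] ≠ 0` — hypothesis `hBlow` of `AretakisInstability.of_leafFacts`, spelled out verbatim;
   it is the conclusion of `Aretakis2015.axisymmetricBlowup_of_decay` (until the review of
   2026-08-15 the named fact `Aretakis2015_axisymmetricBlowup` of
   `ExtremalHorizonAxisymmetricDecay.lean`, a proved slice of `Aretakis2015_scalarInstability`
   merged back together with it),

and so that the discharge of the barrier, once the two leaves are discharged, is the one line
`theorem AretakisInstability_holds : AretakisInstability :=
  AretakisInstability.of_twoLeaves KerrSchild.waveCauchyProblem_holds Aretakis2012_pointwiseDecay_holds`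
(`ExtremalHorizonInstabilityNarrowLeaves.lean`, which imports this file and
`ExtremalHorizonBlowupProofs.lean`; equivalently `AretakisInstability.of_leafFacts h₁ h₂
(Aretakis2015.axisymmetricBlowup_of_decay h₂)`, or `AretakisInstability.of_kerrSchild h₁
(Aretakis2015.scalarInstability_of_decay h₂)`). This file introduces no definition and no named
fact; in particular the Cauchy problem enters only through leaf 1 — the chart-level Cauchy problem
on extremal Kerr is not a separate named fact (review of 2026-08-15, D-0026/D-0027: it is the proved
conditional theorem `Kerr.extremal_waveCauchy_of_kerrSchild`, the specialisation
`Kerr.exists_wave_of_data` of leaf 1) — and Thm. 3 enters only as the verbatim hypothesis `hA`.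

## References

* S. Aretakis, *Horizon instability of extremal black holes*, Adv. Theor. Math. Phys. 19 (2015)
  507–530 (arXiv:1206.6598), §5.2, Prop. 5.1 and Thm. 3 (p. 12) (key `Aretakis2015`).
* S. Aretakis, *Decay of axisymmetric solutions of the wave equation on extreme Kerr
  backgrounds*, J. Funct. Anal. 263 (2012) 2770–2831, Thm. 5 (key `Aretakis2012`).
* C. Bär, N. Ginoux, F. Pfäffle, *Wave equations on Lorentzian manifolds and quantization*, EMS
  2007 (arXiv:0806.1036), Thm. 3.2.11 (key `BarGinouxPfaffle2007`).
* Y. Choquet-Bruhat, S. Cotsakis, *Global hyperbolicity and completeness*, J. Geom. Phys. 43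
  (2002), Thm. 2.1 (key `ChoquetbruhatCotsakis2002`).
-/

open scoped Manifold ContDiff

namespace Literature.Barriers.FinalStateConjecture

open Literature.Geometry.Lorentzian

/-- **Reduction (proved): the Aretakis barrier from the chart-level Cauchy problem and Thm. 3.**
`AretakisInstability` follows from the Cauchy problem for generalised Kerr–Schild wave operators
on `ℝ⁴` (`KerrSchild.waveCauchyProblem`) and Aretakis's Thm. 3, clauses `k = 1, 2`, in universal
asymptotic form — hypothesis `hA`, verbatim the conclusion of `Aretakis2015.scalarInstability_of_facts`
(`ExtremalHorizonInstabilityAssembly.lean`, where its rendering of the printed statement is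
documented) and of `Aretakis2015.scalarInstability_of_decay` (`ExtremalHorizonBlowupProofs.lean`);
until the review of 2026-08-15 the named fact `Aretakis2015_scalarInstability`. The leaf fact gives
the chart-level Cauchy problem on extremal Kerr (`Kerr.extremal_waveCauchy_of_kerrSchild`: metric
surgery inside `{r ≤ r₀}`, solve on the surgered background, restrict to the chart), and
`AretakisInstability.of_facts` (through the composite `AretakisInstability.of_waveCauchy` of
`ExtremalHorizonInstabilityCauchyProofs.lean`, of which this theorem is a synonym) turns any such
solution operator and Thm. 3 into the barrier (localised data `(horizonBumpData, 0)` of Aretakis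
charge `16πM² ≠ 0`, asymptotic lower bounds from time `τ₁` on, translation by `s = max τ₁ 0` along
the stationary Killing flow). Aretakis, ATMP 19 (2015), Thm. 3; Bär–Ginoux–Pfäffle 2007,
Thm. 3.2.11 on the surgered spacetime `(ℝ⁴, η + φ ℓ ⊗ ℓ)`, globally hyperbolic by
Choquet-Bruhat–Cotsakis 2002, Thm. 2.1. [cite: Aretakis2015, Thm. 3] -/
theorem AretakisInstability.of_kerrSchild
    (hKS : Literature.Geometry.Lorentzian.KerrSchild.waveCauchyProblem)
    (hA :
      ∀ [Kerr.Facts] [Kerr.SliceFacts] (M : ℝ), 0 < M → ∀ r₀ ∈ Set.Ioo 0 M,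
        ∃ c > (0 : ℝ), ∀ (U : Set (Kerr.region M r₀)) (ψ : Kerr.region M r₀ → ℝ),
          IsOpen U →
          {x : Kerr.region M r₀ | Kerr.rPlus M M ≤ Kerr.radius M (x : E4) ∧ 0 ≤ (x : E4) 0} ⊆ U →
          ContMDiffOn 𝓘(ℝ, E4) 𝓘(ℝ, ℝ) ∞ ψ U →
          (∀ x ∈ U, (Kerr.smoothMetric M M r₀).toPseudoRiemannianMetric.dalembertian ψ x = 0) →
          (∃ ρ : ℝ, ∀ x ∈ U, (x : E4) 0 = 0 → ρ < E4.spatialNorm (x : E4) →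
            ψ x = 0 ∧ mfderiv 𝓘(ℝ, E4) 𝓘(ℝ, ℝ) ψ x = 0) →
          aretakisCharge M r₀ ψ ≠ 0 →
          ∃ τ₁ : ℝ, ∀ τ : ℝ, τ₁ ≤ τ →
            (∃ x ∈ Kerr.horizonSection M M r₀ τ,
              c * |aretakisCharge M r₀ ψ| ≤ |Kerr.transversalDeriv M r₀ ψ x|) ∧
            (∃ x ∈ Kerr.horizonSection M M r₀ τ,
              c * |aretakisCharge M r₀ ψ| * τ ≤
                |Kerr.transversalDeriv M r₀ (Kerr.transversalDeriv M r₀ ψ) x|)) :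
    Literature.Barriers.FinalStateConjecture.AretakisInstability :=
  AretakisInstability.of_waveCauchy hKS hA

/-- **Reduction (proved): the Aretakis barrier from its analytic leaves.** On extremal Kerr
`a = M`, the existence of a smooth solution of `□_g ψ = 0` with localised data whose transversal
derivative `Yψ` does not decay along `𝓗⁺` and whose second transversal derivative `YYψ` grows
linearly along `𝓗⁺` (`AretakisInstability`, Aretakis, ATMP 19 (2015), Thm. 3, existence form)
follows from (1) the global Cauchy problem for divergence-form wave operators of generalised
Kerr–Schild metrics on `ℝ⁴` (`KerrSchild.waveCauchyProblem`), (2) the pointwise decay of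
axisymmetric solutions on extremal Kerr (Aretakis, JFA 263 (2012), Thm. 5;
`Aretakis2012_pointwiseDecay`) and (3) the `k = 2` blow-up for axisymmetric solutions with
non-zero Aretakis charge (Thm. 3, clause `k = 2`; hypothesis `hBlow`, verbatim the conclusion of
`Aretakis2015.axisymmetricBlowup_of_decay`, `ExtremalHorizonBlowupProofs.lean`, which PROVES it
from (2); until the review of 2026-08-15 the named fact `Aretakis2015_axisymmetricBlowup`) — the
conservation law of Prop. 5.1 (`Aretakis2015_chargeConservation_holds`), the projection to the
zeroth azimuthal frequency, the bump data of charge `16πM²` and the metric surgery being proved in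
the imported files. This is the printed proof of Thm. 3 ("Combining the methods of [aretakis2],
the results of the present paper and [aretakis3] and by projecting to the zeroth azimuthal
frequency") with its inputs named. [cite: Aretakis2015, Thm. 3 (p. 12) and §5.2] -/
theorem AretakisInstability.of_leafFacts
    (hKS : Literature.Geometry.Lorentzian.KerrSchild.waveCauchyProblem)
    (hDec : Literature.Barriers.FinalStateConjecture.Aretakis2012_pointwiseDecay)
    (hBlow :
      ∀ [Kerr.Facts] [Kerr.SliceFacts] (M : ℝ), 0 < M → ∀ r₀ ∈ Set.Ioo 0 M,
        ∃ c > (0 : ℝ), ∀ (U : Set (Kerr.region M r₀)) (ψ : Kerr.region M r₀ → ℝ),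
          IsOpen U →
          {x : Kerr.region M r₀ | Kerr.rPlus M M ≤ Kerr.radius M (x : E4) ∧ 0 ≤ (x : E4) 0} ⊆ U →
          ContMDiffOn 𝓘(ℝ, E4) 𝓘(ℝ, ℝ) ∞ ψ U →
          (∀ x ∈ U, (Kerr.smoothMetric M M r₀).toPseudoRiemannianMetric.dalembertian ψ x = 0) →
          (∃ ρ : ℝ, ∀ x ∈ U, (x : E4) 0 = 0 → ρ < E4.spatialNorm (x : E4) →
            ψ x = 0 ∧ mfderiv 𝓘(ℝ, E4) 𝓘(ℝ, ℝ) ψ x = 0) →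
          Kerr.IsAxisymmetric ψ →
          aretakisCharge M r₀ ψ ≠ 0 →
          ∃ τ₁ : ℝ, ∀ τ : ℝ, τ₁ ≤ τ →
            ∃ x ∈ Kerr.horizonSection M M r₀ τ,
              c * |aretakisCharge M r₀ ψ| * τ ≤
                |Kerr.transversalDeriv M r₀ (Kerr.transversalDeriv M r₀ ψ) x|) :
    Literature.Barriers.FinalStateConjecture.AretakisInstability :=
  AretakisInstability.of_kerrSchild hKS (Aretakis2015.scalarInstability_of_facts hDec hBlow)

end Literature.Barriers.FinalStateConjecture
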